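import Summits.BirchSwinnertonDyer.BirchSwinnertonDyer.Theorems.QuadraticBranchSignedControlPlusEtaNonsurjConjADoorUnitBSD
import Summits.BirchSwinnertonDyer.Rank1Residual.X11b.ChaPairsMinimality
import Summits.BirchSwinnertonDyer.Rank1Residual.X11b.KrausMinimalityGeneralTwo
import Summits.BirchSwinnertonDyer.BirchSwinnertonDyer.Theorems.QuadraticBranchSignedControlPlusEtaNonsurjCMUnitRecords08
import HarnessLib

/-!
# Route `QuadraticBranchSignedControl` (rung K8, cell `bsd-potss`), residual crux `PlusEtaMainConjectureNonsurj`
# (stmt-BirchSwinnertonDyer-19606): IN-TABLE `BSD_5` UNIT RECORDS TU(e) — `MissingPPartAt W 5` (ord₅ #Ш(W) = ord₅ #Ш_an(W)) on rank-ZERO UNIT rows of the K8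
# table (CM CornerF and non-CM rows, Cremona labels) through the unit-row door, modulo named published facts ONLY — no `L₀`, no `BSD` input, no open crux
# (seat `bsd-potss-k8eta-c2` g22)

WHAT. g20/g21's in-table census (QP5 / E5, GRH) lists 66 rank-zero rows with PARI plus-`η` `(λ, μ) = (0, 0)` — `L_5⁺(V,η,T)` a UNIT of `Λ` — and a
class-group door PASS (51 L6 `5 ∤ h(ℚ(P))`, 6 L2, 8 L4 Hecke, 1 L6⁻); 61 of them are CM (the cell's CornerF: additive potentially supersingular `5`), 5
non-CM. The unit-row door (p715862) gives (C1⁺_η)(V) from (A)(W,5) + the unit certificate, and p717939's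
`EtaConjADoorUnitBSD.missingPPartAt_of_{not_dvd_classNumber,eigenHom,heckeEigenHom,relClassNumber}_of_isUnit` composes with the η→F seam, the PROVED plus
transport, KO13 and exact even control to `MissingPPartAt W 5`, CONDITIONAL on the named facts `hGZK hmod hnf hM h12 hKO h22 h41 h6273` and the displayed
row data (`r_an(W) = 0`, the twin `V` with its tower clause, the unit certificate, the class-group datum) — contrast k8eta-c2 g2's `EtaUnitRows` (192 CM
unit rows OUTSIDE the table, which needed `Sel_{5^∞}(W/ℚ) = 0`, i.e. BSD-side input). Rows of this part: 416025bc1 (CM, door L2, `h(ℚ(P)) = 420`), 416025bd1 (CM, door L6, `h(ℚ(P)) = 4`), 81675i1 (CM, door L6, `h(ℚ(P)) = 4`), 1225b1 (CM, door L6, `h(ℚ(P)) = 1`), 132300es1 (CM, door L6, `h(ℚ(P)) = 9`). Kernel per curve: `Δ ≠ 0`, global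
minimality (Kraus/Silverman support certificate, `decide`).

HONEST FRAMING (cell `bsd-potss`; FULL-BSD rank ≤ 1 programme, HUMAN RULING D-0036/D-0074): per-row RECORDS, CONDITIONAL on the displayed named facts and
per-row data (GRH class numbers [/ Hecke eigenvalue], PARI `λ⁺, μ⁺`, Cremona rank 0, the twin `V` with its tower clause); numerics are evidence, not kernel
facts; `BSD(W,5)` ASSERTED for no pair; no stub of 19606 proved; crux and route OPEN; nothing booked. `--supports stmt-BirchSwinnertonDyer-19606`.

References: [Kobayashi2003] Thm. 1.2, 2.2, (3.6), §4, Thm. 4.1, 6.2–7.3, 9.3; [KitajimaOtsuki2018] Main Thm. 1.3; [Mazur1978] Cor. 4.1; [Miller2011LMS] Def. 1.1;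
[CoatesSujatha2005] §3 (A), Thm. 3.4; [DeoRaySujatha2023] Thm. 3.8–3.9; [NeukirchANT1999] III §1 (1.6); [SilvermanAEC2009] VII.1 Rem. 1.1; [Cremona1997] Table 1.
-/

set_option autoImplicit false
set_option linter.dupNamespace false
noncomputable section

open scoped Classical nonZeroDivisors

open CongruenceSubgroup NumberField Field WeierstrassCurve
open Literature.NumberTheory.EllipticCurves Literature.NumberTheory.EllipticCurves.ModularForms
  Literature.NumberTheory.EllipticCurves.Rank1Residual Literature.NumberTheory.EllipticCurves.Rank1Residual.Typed
  Literature.NumberTheory.GaloisRepresentations Literature.NumberTheory.GaloisCohomology Literature.NumberTheory.NumberFields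
  Literature.NumberTheory.EllipticCurves.GreenbergVatsal2000 ZpExtension
open Summit.BirchSwinnertonDyer.Rank1Residual Summit.BirchSwinnertonDyer.Rank1Residual.Additive
open Summit.BirchSwinnertonDyer.Rank1Residual.X11b (isElliptic_of_discOf_ne_zero)
open Summit.BirchSwinnertonDyer.BirchSwinnertonDyer.Theorems
open Summit.BirchSwinnertonDyer.Rank1Residual.X11b (isElliptic_of_discOf_ne_zero isGloballyMinimal_of_krausCriterion_support)

namespace Summit.BirchSwinnertonDyer.BirchSwinnertonDyer.Theorems.EtaConjADoorUnitBSDRecords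

/-- The K8 table row `W = [0, 0, 1, 0, -4594013844]` (Cremona label 416025bc1, CM, `N_W = 416025`, additive at `5`): `Δ ≠ 0` (kernel). [cite:
Cremona1997, Table 1] -/
theorem isElliptic_416025bc1 : (⟨0, 0, 1, 0, (-4594013844)⟩ : WeierstrassCurve ℚ).IsElliptic :=
  isElliptic_of_discOf_ne_zero 0 0 1 0 (-4594013844) (by decide +kernel)

set_option maxRecDepth 100000 in
/-- `W = [0, 0, 1, 0, -4594013844]` is a global minimal equation (Silverman VII.1 Rem. 1.1 on the support `|Δ| = 3^3 · 5^6 · 43^10` — at every prime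
`q` of the support `q¹² ∤ Δ` or `q⁴ ∤ c₄`, or Kraus's test at `2`; tree `isGloballyMinimal_of_krausCriterion_support`, kernel `decide`). [cite:
SilvermanAEC2009, VII.1 Remark 1.1] [cite: Kraus1989, Prop. 1 and Prop. 2] -/
theorem isGloballyMinimal_416025bc1 : (⟨0, 0, 1, 0, (-4594013844)⟩ : WeierstrassCurve ℚ).IsGloballyMinimal :=
  isGloballyMinimal_of_krausCriterion_support 0 0 1 0 (-4594013844) [(3, 0, 3), (5, 0, 6), (43, 0, 10)]
    (by
      intro t ht
      simp only [List.mem_cons, List.not_mem_nil, or_false] at ht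
      rcases ht with rfl | rfl | rfl <;> norm_num)
    (by decide +kernel) (by decide +kernel)

/-- **`MissingPPartAt W 5` — `ord_5 #Ш(W) = ord_5 #Ш_an(W)`, the `5`-part of `BSD(W,5)` — for the CM CornerF in-table UNIT UNIT partner 416025bc1,
granted ONE good `a_5 = 0` globally minimal model `V` of `W^{(5)}` with non-onto `5`-adic tower** (`W = [0, 0, 1, 0, -4594013844]`, CM, `N_W =
416025`; kit QP5 (k8eta-c2 g20) / j326603 (g21) (GRH): `ε(W) = +1`, PARI plus-`η` `(λ, μ) = (0, 0)` — `L_5⁺(V,η,T)` is a UNIT of `Λ` —, `r_an(W) =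
0` (`Cremona rank 0, L(W,1) ≠ 0`); `h(ℚ(P)) = 420`, `h(ℚ(x(P))) = 21`; eigen dimensions `(d₁,d₂,d₃,d₄) = (0,0,1,0)` — door L2 (`2` is not an
eigenvalue of `σ₂`) passes) from the ROW ALONE — named facts `hGZK hmod hnf hM h12 hKO h22 h41 h6273` (GZK, modularity, newforms, Mazur `p ∤ c₀`,
Kobayashi Thm. 1.2 / 2.2 / 4.1 / 6.2–7.3, Kitajima–Otsuki Thm. 1.3; Poitou–Tate and the plus transport are tree theorems); displayed: `r_an(W) = 0`,
the twin `V` with the tower clause, the unit certificate «every `L_5⁺(V,η,T)` is a unit», the class-group datum. Instance of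
`EtaConjADoorUnitBSD.missingPPartAt_of_eigenHom_of_isUnit` (k8eta-c2 g22). CONDITIONAL; nothing booked. [cite: Kobayashi2003, §4 (p. 8), Thm. 2.2
(p. 5)] [cite: CoatesSujatha2005, §3 (A) and Thm. 3.4] [cite: Cremona1997, Table 1] -/
theorem missingPPartAt_416025bc1_5_of_eigenHom
    (hGZK : rank_eq_analyticRank_of_analyticRank_le_one) (hmod : hasEntireLFunction_rat)
    (hnf : exists_isNewformOf) (hM : mazur_not_dvd_maninConstant_of_odd)
    (h12 : Kobayashi2003.thm12_signedSelmerDual_finite_torsion)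
    (hKO : KitajimaOtsuki2018.mainThm13_etaSignedSelmerDual_noFiniteSubmodule)
    (h22 : Kobayashi2003.thm22_etaSignedSelmerDual_finite_torsion)
    (h41 : Kobayashi2003.thm41_plusEtaCharIdeal_dvd)
    (h6273 : Kobayashi2003.thm62_63_73_etaColemanPoitouTate) [Fact (5 : ℕ).Prime]
    (W : WeierstrassCurve ℚ) (hW : W = (⟨0, 0, 1, 0, (-4594013844)⟩ : WeierstrassCurve ℚ))
    (V : WeierstrassCurve ℚ) [V.IsElliptic] [V.IsGloballyMinimal] (C : VariableChange ℚ)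
    (hC : C • W.quadraticTwist 5 = V)
    (hgood : V.HasGoodReductionAtPrime 5) (hap : V.frobeniusTrace 5 = 0)
    (hns : ¬ ∀ m : ℕ, V.HasSurjectiveModNGaloisRep (5 ^ m : ℕ))
    (hunit : ∀ {N : ℕ} [NeZero N] {f : CuspForm (Gamma0 N) 2}, IsNewformOf V f →
      ∀ (ϖ : ℚ), (if Even (5 / 2) then (ϖ : ℝ) * V.realPeriodRat = plusPeriod f
          else (ϖ : ℝ) * V.imaginaryPeriodRat = minusPeriod f) →
      ∀ (Lη : IwasawaAlgebra 5), IsQuadraticBranchPlusLFunction f 5 ϖ Lη → IsUnit Lη)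
    (hP : haveI : W.IsElliptic := hW ▸ isElliptic_416025bc1
      haveI : NeZero (5 : ℕ) := ⟨by norm_num⟩
      haveI : NumberField (W.divisionField 5) := NumberField.mk
      ∃ P : geomTorsion W ((5 : ℕ) : ℤ), P ≠ 0 ∧
        ∀ K : IntermediateField ℚ (W.divisionField 5),
          K = IntermediateField.fixedField
            ((MulAction.stabilizer (absoluteGaloisGroup ℚ) P).map (absRestrictNormalHom (W.divisionField 5))) →
        ∀ μ : Additive (ClassGroup (𝓞 K)) →+ ZMod 5,
          (∀ (τ : absoluteGaloisGroup ℚ) (σ : K ≃ₐ[ℚ] K) (a : ℕ),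
              (∀ x : K, absRestrictNormalHom (W.divisionField 5) τ (x : W.divisionField 5) =
                ((σ x : K) : W.divisionField 5)) → τ • P = a • P →
              ∀ (I J : (Ideal (𝓞 K))⁰),
                (J : Ideal (𝓞 K)) = (I : Ideal (𝓞 K)).map (AmbiguousClass.intAut σ : 𝓞 K →+* 𝓞 K) →
                μ (Additive.ofMul (ClassGroup.mk0 J)) = a • μ (Additive.ofMul (ClassGroup.mk0 I))) →
          μ = 0) (hr0 : W.analyticRank = 0) :
    MissingPPartAt W 5 := by
  subst hW
  haveI : (⟨0, 0, 1, 0, (-4594013844)⟩ : WeierstrassCurve ℚ).IsElliptic := isElliptic_416025bc1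
  haveI : (⟨0, 0, 1, 0, (-4594013844)⟩ : WeierstrassCurve ℚ).IsGloballyMinimal := isGloballyMinimal_416025bc1
  haveI : NeZero (5 : ℕ) := ⟨by norm_num⟩
  exact EtaConjADoorUnitBSD.missingPPartAt_of_eigenHom_of_isUnit _ 5 hGZK hmod hnf hM h12 hKO h22 h41 h6273 (le_refl 5) V C
    (by rw [show ((-1 : ℚ) ^ ((5 : ℕ) / 2) * ((5 : ℕ) : ℚ)) = 5 by norm_num]; exact hC) hgood hap hns hP hunit hr0

/-- The K8 table row `W = [0, 0, 1, -193500, -32761969]` (Cremona label 416025bd1, CM, `N_W = 416025`, additive at `5`): `Δ ≠ 0` (kernel). [cite: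
Cremona1997, Table 1] -/
theorem isElliptic_416025bd1 : (⟨0, 0, 1, (-193500), (-32761969)⟩ : WeierstrassCurve ℚ).IsElliptic :=
  isElliptic_of_discOf_ne_zero 0 0 1 (-193500) (-32761969) (by decide +kernel)

set_option maxRecDepth 100000 in
/-- `W = [0, 0, 1, -193500, -32761969]` is a global minimal equation (Silverman VII.1 Rem. 1.1 on the support `|Δ| = 3^6 · 5^6 · 43^3` — at every
prime `q` of the support `q¹² ∤ Δ` or `q⁴ ∤ c₄`, or Kraus's test at `2`; tree `isGloballyMinimal_of_krausCriterion_support`, kernel `decide`).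
[cite: SilvermanAEC2009, VII.1 Remark 1.1] [cite: Kraus1989, Prop. 1 and Prop. 2] -/
theorem isGloballyMinimal_416025bd1 : (⟨0, 0, 1, (-193500), (-32761969)⟩ : WeierstrassCurve ℚ).IsGloballyMinimal :=
  isGloballyMinimal_of_krausCriterion_support 0 0 1 (-193500) (-32761969) [(3, 0, 6), (5, 0, 6), (43, 0, 3)]
    (by
      intro t ht
      simp only [List.mem_cons, List.not_mem_nil, or_false] at ht
      rcases ht with rfl | rfl | rfl <;> norm_num)
    (by decide +kernel) (by decide +kernel)

/-- **`MissingPPartAt W 5` — `ord_5 #Ш(W) = ord_5 #Ш_an(W)`, the `5`-part of `BSD(W,5)` — for the CM CornerF in-table UNIT UNIT partner 416025bd1,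
granted ONE good `a_5 = 0` globally minimal model `V` of `W^{(5)}` with non-onto `5`-adic tower** (`W = [0, 0, 1, -193500, -32761969]`, CM, `N_W =
416025`; kit QP5 (k8eta-c2 g20) / j326603 (g21) (GRH): `ε(W) = +1`, PARI plus-`η` `(λ, μ) = (0, 0)` — `L_5⁺(V,η,T)` is a UNIT of `Λ` —, `r_an(W) =
0` (`Cremona rank 0, L(W,1) ≠ 0`); `h(ℚ(P)) = 4`, `h(ℚ(x(P))) = 1`; eigen dimensions `(d₁,d₂,d₃,d₄) = (0,0,0,0)` — door L6 (`5 ∤ h(ℚ(P))`) passes)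
from the ROW ALONE — named facts `hGZK hmod hnf hM h12 hKO h22 h41 h6273` (GZK, modularity, newforms, Mazur `p ∤ c₀`, Kobayashi Thm. 1.2 / 2.2 / 4.1
/ 6.2–7.3, Kitajima–Otsuki Thm. 1.3; Poitou–Tate and the plus transport are tree theorems); displayed: `r_an(W) = 0`, the twin `V` with the tower
clause, the unit certificate «every `L_5⁺(V,η,T)` is a unit», the class-group datum. Instance of
`EtaConjADoorUnitBSD.missingPPartAt_of_not_dvd_classNumber_of_isUnit` (k8eta-c2 g22). CONDITIONAL; nothing booked. [cite: Kobayashi2003, §4 (p. 8),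
Thm. 2.2 (p. 5)] [cite: CoatesSujatha2005, §3 (A) and Thm. 3.4] [cite: Cremona1997, Table 1] -/
theorem missingPPartAt_416025bd1_5_of_classNumber
    (hGZK : rank_eq_analyticRank_of_analyticRank_le_one) (hmod : hasEntireLFunction_rat)
    (hnf : exists_isNewformOf) (hM : mazur_not_dvd_maninConstant_of_odd)
    (h12 : Kobayashi2003.thm12_signedSelmerDual_finite_torsion)
    (hKO : KitajimaOtsuki2018.mainThm13_etaSignedSelmerDual_noFiniteSubmodule)
    (h22 : Kobayashi2003.thm22_etaSignedSelmerDual_finite_torsion)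
    (h41 : Kobayashi2003.thm41_plusEtaCharIdeal_dvd)
    (h6273 : Kobayashi2003.thm62_63_73_etaColemanPoitouTate) [Fact (5 : ℕ).Prime]
    (W : WeierstrassCurve ℚ) (hW : W = (⟨0, 0, 1, (-193500), (-32761969)⟩ : WeierstrassCurve ℚ))
    (V : WeierstrassCurve ℚ) [V.IsElliptic] [V.IsGloballyMinimal] (C : VariableChange ℚ)
    (hC : C • W.quadraticTwist 5 = V)
    (hgood : V.HasGoodReductionAtPrime 5) (hap : V.frobeniusTrace 5 = 0)
    (hns : ¬ ∀ m : ℕ, V.HasSurjectiveModNGaloisRep (5 ^ m : ℕ))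
    (hunit : ∀ {N : ℕ} [NeZero N] {f : CuspForm (Gamma0 N) 2}, IsNewformOf V f →
      ∀ (ϖ : ℚ), (if Even (5 / 2) then (ϖ : ℝ) * V.realPeriodRat = plusPeriod f
          else (ϖ : ℝ) * V.imaginaryPeriodRat = minusPeriod f) →
      ∀ (Lη : IwasawaAlgebra 5), IsQuadraticBranchPlusLFunction f 5 ϖ Lη → IsUnit Lη)
    (hP : haveI : W.IsElliptic := hW ▸ isElliptic_416025bd1
      haveI : NeZero (5 : ℕ) := ⟨by norm_num⟩
      haveI : NumberField (W.divisionField 5) := NumberField.mk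
      ∃ P : geomTorsion W ((5 : ℕ) : ℤ), P ≠ 0 ∧
        ¬ 5 ∣ NumberField.classNumber (IntermediateField.fixedField
          ((MulAction.stabilizer (absoluteGaloisGroup ℚ) P).map (absRestrictNormalHom (W.divisionField 5))))) (hr0 : W.analyticRank = 0) :
    MissingPPartAt W 5 := by
  subst hW
  haveI : (⟨0, 0, 1, (-193500), (-32761969)⟩ : WeierstrassCurve ℚ).IsElliptic := isElliptic_416025bd1
  haveI : (⟨0, 0, 1, (-193500), (-32761969)⟩ : WeierstrassCurve ℚ).IsGloballyMinimal := isGloballyMinimal_416025bd1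
  haveI : NeZero (5 : ℕ) := ⟨by norm_num⟩
  exact EtaConjADoorUnitBSD.missingPPartAt_of_not_dvd_classNumber_of_isUnit _ 5 hGZK hmod hnf hM h12 hKO h22 h41 h6273 (le_refl 5) V C
    (by rw [show ((-1 : ℚ) ^ ((5 : ℕ) / 2) * ((5 : ℕ) : ℚ)) = 5 by norm_num]; exact hC) hgood hap hns hP hunit hr0

/-- The K8 table row `W = [0, 0, 1, 0, -41594]` (Cremona label 81675i1, CM, `N_W = 81675`, additive at `5`): `Δ ≠ 0` (kernel). [cite: Cremona1997,
Table 1] -/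
theorem isElliptic_81675i1 : (⟨0, 0, 1, 0, (-41594)⟩ : WeierstrassCurve ℚ).IsElliptic :=
  isElliptic_of_discOf_ne_zero 0 0 1 0 (-41594) (by decide +kernel)

set_option maxRecDepth 100000 in
/-- `W = [0, 0, 1, 0, -41594]` is a global minimal equation (Silverman VII.1 Rem. 1.1 on the support `|Δ| = 3^3 · 5^6 · 11^6` — at every prime `q`
of the support `q¹² ∤ Δ` or `q⁴ ∤ c₄`, or Kraus's test at `2`; tree `isGloballyMinimal_of_krausCriterion_support`, kernel `decide`). [cite:
SilvermanAEC2009, VII.1 Remark 1.1] [cite: Kraus1989, Prop. 1 and Prop. 2] -/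
theorem isGloballyMinimal_81675i1 : (⟨0, 0, 1, 0, (-41594)⟩ : WeierstrassCurve ℚ).IsGloballyMinimal :=
  isGloballyMinimal_of_krausCriterion_support 0 0 1 0 (-41594) [(3, 0, 3), (5, 0, 6), (11, 0, 6)]
    (by
      intro t ht
      simp only [List.mem_cons, List.not_mem_nil, or_false] at ht
      rcases ht with rfl | rfl | rfl <;> norm_num)
    (by decide +kernel) (by decide +kernel)

/-- **`MissingPPartAt W 5` — `ord_5 #Ш(W) = ord_5 #Ш_an(W)`, the `5`-part of `BSD(W,5)` — for the CM CornerF in-table UNIT UNIT partner 81675i1,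
granted ONE good `a_5 = 0` globally minimal model `V` of `W^{(5)}` with non-onto `5`-adic tower** (`W = [0, 0, 1, 0, -41594]`, CM, `N_W = 81675`;
kit QP5 (k8eta-c2 g20) / j326603 (g21) (GRH): `ε(W) = +1`, PARI plus-`η` `(λ, μ) = (0, 0)` — `L_5⁺(V,η,T)` is a UNIT of `Λ` —, `r_an(W) = 0`
(`Cremona rank 0, L(W,1) ≠ 0`); `h(ℚ(P)) = 4`, `h(ℚ(x(P))) = 1`; eigen dimensions `(d₁,d₂,d₃,d₄) = (0,0,0,0)` — door L6 (`5 ∤ h(ℚ(P))`) passes) from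
the ROW ALONE — named facts `hGZK hmod hnf hM h12 hKO h22 h41 h6273` (GZK, modularity, newforms, Mazur `p ∤ c₀`, Kobayashi Thm. 1.2 / 2.2 / 4.1 /
6.2–7.3, Kitajima–Otsuki Thm. 1.3; Poitou–Tate and the plus transport are tree theorems); displayed: `r_an(W) = 0`, the twin `V` with the tower
clause, the unit certificate «every `L_5⁺(V,η,T)` is a unit», the class-group datum. Instance of
`EtaConjADoorUnitBSD.missingPPartAt_of_not_dvd_classNumber_of_isUnit` (k8eta-c2 g22). CONDITIONAL; nothing booked. [cite: Kobayashi2003, §4 (p. 8),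
Thm. 2.2 (p. 5)] [cite: CoatesSujatha2005, §3 (A) and Thm. 3.4] [cite: Cremona1997, Table 1] -/
theorem missingPPartAt_81675i1_5_of_classNumber
    (hGZK : rank_eq_analyticRank_of_analyticRank_le_one) (hmod : hasEntireLFunction_rat)
    (hnf : exists_isNewformOf) (hM : mazur_not_dvd_maninConstant_of_odd)
    (h12 : Kobayashi2003.thm12_signedSelmerDual_finite_torsion)
    (hKO : KitajimaOtsuki2018.mainThm13_etaSignedSelmerDual_noFiniteSubmodule)
    (h22 : Kobayashi2003.thm22_etaSignedSelmerDual_finite_torsion)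
    (h41 : Kobayashi2003.thm41_plusEtaCharIdeal_dvd)
    (h6273 : Kobayashi2003.thm62_63_73_etaColemanPoitouTate) [Fact (5 : ℕ).Prime]
    (W : WeierstrassCurve ℚ) (hW : W = (⟨0, 0, 1, 0, (-41594)⟩ : WeierstrassCurve ℚ))
    (V : WeierstrassCurve ℚ) [V.IsElliptic] [V.IsGloballyMinimal] (C : VariableChange ℚ)
    (hC : C • W.quadraticTwist 5 = V)
    (hgood : V.HasGoodReductionAtPrime 5) (hap : V.frobeniusTrace 5 = 0)
    (hns : ¬ ∀ m : ℕ, V.HasSurjectiveModNGaloisRep (5 ^ m : ℕ))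
    (hunit : ∀ {N : ℕ} [NeZero N] {f : CuspForm (Gamma0 N) 2}, IsNewformOf V f →
      ∀ (ϖ : ℚ), (if Even (5 / 2) then (ϖ : ℝ) * V.realPeriodRat = plusPeriod f
          else (ϖ : ℝ) * V.imaginaryPeriodRat = minusPeriod f) →
      ∀ (Lη : IwasawaAlgebra 5), IsQuadraticBranchPlusLFunction f 5 ϖ Lη → IsUnit Lη)
    (hP : haveI : W.IsElliptic := hW ▸ isElliptic_81675i1
      haveI : NeZero (5 : ℕ) := ⟨by norm_num⟩
      haveI : NumberField (W.divisionField 5) := NumberField.mk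
      ∃ P : geomTorsion W ((5 : ℕ) : ℤ), P ≠ 0 ∧
        ¬ 5 ∣ NumberField.classNumber (IntermediateField.fixedField
          ((MulAction.stabilizer (absoluteGaloisGroup ℚ) P).map (absRestrictNormalHom (W.divisionField 5))))) (hr0 : W.analyticRank = 0) :
    MissingPPartAt W 5 := by
  subst hW
  haveI : (⟨0, 0, 1, 0, (-41594)⟩ : WeierstrassCurve ℚ).IsElliptic := isElliptic_81675i1
  haveI : (⟨0, 0, 1, 0, (-41594)⟩ : WeierstrassCurve ℚ).IsGloballyMinimal := isGloballyMinimal_81675i1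
  haveI : NeZero (5 : ℕ) := ⟨by norm_num⟩
  exact EtaConjADoorUnitBSD.missingPPartAt_of_not_dvd_classNumber_of_isUnit _ 5 hGZK hmod hnf hM h12 hKO h22 h41 h6273 (le_refl 5) V C
    (by rw [show ((-1 : ℚ) ^ ((5 : ℕ) / 2) * ((5 : ℕ) : ℚ)) = 5 by norm_num]; exact hC) hgood hap hns hP hunit hr0

/-- The K8 table row `W = [1, -1, 1, -55, -178]` (Cremona label 1225b1, CM, `N_W = 1225`, additive at `5`): `Δ ≠ 0` (kernel). [cite: Cremona1997,
Table 1] -/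
theorem isElliptic_1225b1 : (⟨1, (-1), 1, (-55), (-178)⟩ : WeierstrassCurve ℚ).IsElliptic :=
  isElliptic_of_discOf_ne_zero 1 (-1) 1 (-55) (-178) (by decide +kernel)

set_option maxRecDepth 100000 in
/-- `W = [1, -1, 1, -55, -178]` is a global minimal equation (Silverman VII.1 Rem. 1.1 on the support `|Δ| = 5^6 · 7^3` — at every prime `q` of the
support `q¹² ∤ Δ` or `q⁴ ∤ c₄`, or Kraus's test at `2`; tree `isGloballyMinimal_of_krausCriterion_support`, kernel `decide`). [cite:
SilvermanAEC2009, VII.1 Remark 1.1] [cite: Kraus1989, Prop. 1 and Prop. 2] -/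
theorem isGloballyMinimal_1225b1 : (⟨1, (-1), 1, (-55), (-178)⟩ : WeierstrassCurve ℚ).IsGloballyMinimal :=
  isGloballyMinimal_of_krausCriterion_support 1 (-1) 1 (-55) (-178) [(5, 0, 6), (7, 0, 3)]
    (by
      intro t ht
      simp only [List.mem_cons, List.not_mem_nil, or_false] at ht
      rcases ht with rfl | rfl <;> norm_num)
    (by decide +kernel) (by decide +kernel)

/-- **`MissingPPartAt W 5` — `ord_5 #Ш(W) = ord_5 #Ш_an(W)`, the `5`-part of `BSD(W,5)` — for the CM CornerF in-table UNIT UNIT partner 1225b1,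
granted ONE good `a_5 = 0` globally minimal model `V` of `W^{(5)}` with non-onto `5`-adic tower** (`W = [1, -1, 1, -55, -178]`, CM, `N_W = 1225`;
kit QP5 (k8eta-c2 g20) / j326603 (g21) (GRH): `ε(W) = +1`, PARI plus-`η` `(λ, μ) = (0, 0)` — `L_5⁺(V,η,T)` is a UNIT of `Λ` —, `r_an(W) = 0`
(`Cremona rank 0, L(W,1) ≠ 0`); `h(ℚ(P)) = 1`, `h(ℚ(x(P))) = 1`; eigen dimensions `(d₁,d₂,d₃,d₄) = (0,0,0,0)` — door L6 (`5 ∤ h(ℚ(P))`) passes) from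
the ROW ALONE — named facts `hGZK hmod hnf hM h12 hKO h22 h41 h6273` (GZK, modularity, newforms, Mazur `p ∤ c₀`, Kobayashi Thm. 1.2 / 2.2 / 4.1 /
6.2–7.3, Kitajima–Otsuki Thm. 1.3; Poitou–Tate and the plus transport are tree theorems); displayed: `r_an(W) = 0`, the twin `V` with the tower
clause, the unit certificate «every `L_5⁺(V,η,T)` is a unit», the class-group datum. Instance of
`EtaConjADoorUnitBSD.missingPPartAt_of_not_dvd_classNumber_of_isUnit` (k8eta-c2 g22). CONDITIONAL; nothing booked. [cite: Kobayashi2003, §4 (p. 8),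
Thm. 2.2 (p. 5)] [cite: CoatesSujatha2005, §3 (A) and Thm. 3.4] [cite: Cremona1997, Table 1] -/
theorem missingPPartAt_1225b1_5_of_classNumber
    (hGZK : rank_eq_analyticRank_of_analyticRank_le_one) (hmod : hasEntireLFunction_rat)
    (hnf : exists_isNewformOf) (hM : mazur_not_dvd_maninConstant_of_odd)
    (h12 : Kobayashi2003.thm12_signedSelmerDual_finite_torsion)
    (hKO : KitajimaOtsuki2018.mainThm13_etaSignedSelmerDual_noFiniteSubmodule)
    (h22 : Kobayashi2003.thm22_etaSignedSelmerDual_finite_torsion)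
    (h41 : Kobayashi2003.thm41_plusEtaCharIdeal_dvd)
    (h6273 : Kobayashi2003.thm62_63_73_etaColemanPoitouTate) [Fact (5 : ℕ).Prime]
    (W : WeierstrassCurve ℚ) (hW : W = (⟨1, (-1), 1, (-55), (-178)⟩ : WeierstrassCurve ℚ))
    (V : WeierstrassCurve ℚ) [V.IsElliptic] [V.IsGloballyMinimal] (C : VariableChange ℚ)
    (hC : C • W.quadraticTwist 5 = V)
    (hgood : V.HasGoodReductionAtPrime 5) (hap : V.frobeniusTrace 5 = 0)
    (hns : ¬ ∀ m : ℕ, V.HasSurjectiveModNGaloisRep (5 ^ m : ℕ))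
    (hunit : ∀ {N : ℕ} [NeZero N] {f : CuspForm (Gamma0 N) 2}, IsNewformOf V f →
      ∀ (ϖ : ℚ), (if Even (5 / 2) then (ϖ : ℝ) * V.realPeriodRat = plusPeriod f
          else (ϖ : ℝ) * V.imaginaryPeriodRat = minusPeriod f) →
      ∀ (Lη : IwasawaAlgebra 5), IsQuadraticBranchPlusLFunction f 5 ϖ Lη → IsUnit Lη)
    (hP : haveI : W.IsElliptic := hW ▸ isElliptic_1225b1
      haveI : NeZero (5 : ℕ) := ⟨by norm_num⟩
      haveI : NumberField (W.divisionField 5) := NumberField.mk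
      ∃ P : geomTorsion W ((5 : ℕ) : ℤ), P ≠ 0 ∧
        ¬ 5 ∣ NumberField.classNumber (IntermediateField.fixedField
          ((MulAction.stabilizer (absoluteGaloisGroup ℚ) P).map (absRestrictNormalHom (W.divisionField 5))))) (hr0 : W.analyticRank = 0) :
    MissingPPartAt W 5 := by
  subst hW
  haveI : (⟨1, (-1), 1, (-55), (-178)⟩ : WeierstrassCurve ℚ).IsElliptic := isElliptic_1225b1
  haveI : (⟨1, (-1), 1, (-55), (-178)⟩ : WeierstrassCurve ℚ).IsGloballyMinimal := isGloballyMinimal_1225b1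
  haveI : NeZero (5 : ℕ) := ⟨by norm_num⟩
  exact EtaConjADoorUnitBSD.missingPPartAt_of_not_dvd_classNumber_of_isUnit _ 5 hGZK hmod hnf hM h12 hKO h22 h41 h6273 (le_refl 5) V C
    (by rw [show ((-1 : ℚ) ^ ((5 : ℕ) / 2) * ((5 : ℕ) : ℚ)) = 5 by norm_num]; exact hC) hgood hap hns hP hunit hr0

/-- **`MissingPPartAt W 5` — `ord_5 #Ш(W) = ord_5 #Ш_an(W)`, the `5`-part of `BSD(W,5)` — for the CM CornerF in-table UNIT UNIT partner 132300es1,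
granted ONE good `a_5 = 0` globally minimal model `V` of `W^{(5)}` with non-onto `5`-adic tower** (`W = [0, 0, 0, 0, 300125]`, CM, `N_W = 132300`;
kit QP5 (k8eta-c2 g20) / j326603 (g21) (GRH): `ε(W) = +1`, PARI plus-`η` `(λ, μ) = (0, 0)` — `L_5⁺(V,η,T)` is a UNIT of `Λ` —, `r_an(W) = 0`
(`Cremona rank 0, L(W,1) ≠ 0`); `h(ℚ(P)) = 9`, `h(ℚ(x(P))) = 9`; eigen dimensions `(d₁,d₂,d₃,d₄) = (0,0,0,0)` — door L6 (`5 ∤ h(ℚ(P))`) passes) from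
the ROW ALONE — named facts `hGZK hmod hnf hM h12 hKO h22 h41 h6273` (GZK, modularity, newforms, Mazur `p ∤ c₀`, Kobayashi Thm. 1.2 / 2.2 / 4.1 /
6.2–7.3, Kitajima–Otsuki Thm. 1.3; Poitou–Tate and the plus transport are tree theorems); displayed: `r_an(W) = 0`, the twin `V` with the tower
clause, the unit certificate «every `L_5⁺(V,η,T)` is a unit», the class-group datum. Instance of
`EtaConjADoorUnitBSD.missingPPartAt_of_not_dvd_classNumber_of_isUnit` (k8eta-c2 g22). CONDITIONAL; nothing booked. [cite: Kobayashi2003, §4 (p. 8),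
Thm. 2.2 (p. 5)] [cite: CoatesSujatha2005, §3 (A) and Thm. 3.4] [cite: Cremona1997, Table 1] -/
theorem missingPPartAt_132300es1_5_of_classNumber
    (hGZK : rank_eq_analyticRank_of_analyticRank_le_one) (hmod : hasEntireLFunction_rat)
    (hnf : exists_isNewformOf) (hM : mazur_not_dvd_maninConstant_of_odd)
    (h12 : Kobayashi2003.thm12_signedSelmerDual_finite_torsion)
    (hKO : KitajimaOtsuki2018.mainThm13_etaSignedSelmerDual_noFiniteSubmodule)
    (h22 : Kobayashi2003.thm22_etaSignedSelmerDual_finite_torsion)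
    (h41 : Kobayashi2003.thm41_plusEtaCharIdeal_dvd)
    (h6273 : Kobayashi2003.thm62_63_73_etaColemanPoitouTate) [Fact (5 : ℕ).Prime]
    (W : WeierstrassCurve ℚ) (hW : W = (⟨0, 0, 0, 0, 300125⟩ : WeierstrassCurve ℚ))
    (V : WeierstrassCurve ℚ) [V.IsElliptic] [V.IsGloballyMinimal] (C : VariableChange ℚ)
    (hC : C • W.quadraticTwist 5 = V)
    (hgood : V.HasGoodReductionAtPrime 5) (hap : V.frobeniusTrace 5 = 0)
    (hns : ¬ ∀ m : ℕ, V.HasSurjectiveModNGaloisRep (5 ^ m : ℕ))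
    (hunit : ∀ {N : ℕ} [NeZero N] {f : CuspForm (Gamma0 N) 2}, IsNewformOf V f →
      ∀ (ϖ : ℚ), (if Even (5 / 2) then (ϖ : ℝ) * V.realPeriodRat = plusPeriod f
          else (ϖ : ℝ) * V.imaginaryPeriodRat = minusPeriod f) →
      ∀ (Lη : IwasawaAlgebra 5), IsQuadraticBranchPlusLFunction f 5 ϖ Lη → IsUnit Lη)
    (hP : haveI : W.IsElliptic := hW ▸ Summit.BirchSwinnertonDyer.BirchSwinnertonDyer.Theorems.EtaCMUnitRecords.isElliptic_132300es1
      haveI : NeZero (5 : ℕ) := ⟨by norm_num⟩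
      haveI : NumberField (W.divisionField 5) := NumberField.mk
      ∃ P : geomTorsion W ((5 : ℕ) : ℤ), P ≠ 0 ∧
        ¬ 5 ∣ NumberField.classNumber (IntermediateField.fixedField
          ((MulAction.stabilizer (absoluteGaloisGroup ℚ) P).map (absRestrictNormalHom (W.divisionField 5))))) (hr0 : W.analyticRank = 0) :
    MissingPPartAt W 5 := by
  subst hW
  haveI : (⟨0, 0, 0, 0, 300125⟩ : WeierstrassCurve ℚ).IsElliptic := Summit.BirchSwinnertonDyer.BirchSwinnertonDyer.Theorems.EtaCMUnitRecords.isElliptic_132300es1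
  haveI : (⟨0, 0, 0, 0, 300125⟩ : WeierstrassCurve ℚ).IsGloballyMinimal := Summit.BirchSwinnertonDyer.BirchSwinnertonDyer.Theorems.EtaCMUnitRecords.isGloballyMinimal_132300es1
  haveI : NeZero (5 : ℕ) := ⟨by norm_num⟩
  exact EtaConjADoorUnitBSD.missingPPartAt_of_not_dvd_classNumber_of_isUnit _ 5 hGZK hmod hnf hM h12 hKO h22 h41 h6273 (le_refl 5) V C
    (by rw [show ((-1 : ℚ) ^ ((5 : ℕ) / 2) * ((5 : ℕ) : ℚ)) = 5 by norm_num]; exact hC) hgood hap hns hP hunit hr0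

end Summit.BirchSwinnertonDyer.BirchSwinnertonDyer.Theorems.EtaConjADoorUnitBSDRecords

end
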